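import Literature.IUT.HodgeArakelov.EtaleThetaDataOfSettingProp24
import Literature.AnabelianGeometry.EtaleTheta.Discharge.Sec2Cor218iModel

/-!
# (H1) `PiYddCharacteristic` of the [EtTh] model from the Thm. 1.6 (i) sub-DAG inputs — NO `Π^tp_Ÿ`-stabilisation assumed
# (proof-only)

abc-iut cell, seat abc-iut-L6-d6 (gen 3). Third kernel supplier of abc-iut-L6-t1's named hypothesis (H1)
`EtaleThetaDataOfSetting.PiYddCharacteristic C` ([IUTchII] Prop. 1.4 / 2.1: "every topological automorphism of `Π^tp_{X̲̲}`
stabilises `Π^tp_{Ÿ̲̲}`" [claim: Mochizuki2012, status: disputed] (IUTchII §1 Prop 1.4, kurims p.27)), after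
`piYddCharacteristic_of_cor218_i` (abc-iut-w4-d013: from the named FACT F-0620) and `piYddCharacteristic_of_prop24`
(p419393: from the [EtTh] Prop. 2.4 (i) binder G-L6d6-2, which ASSUMES the `Π^tp_Ÿ`-stabilisation of the extension): here the
`Π^tp_Ÿ`-clause is DERIVED, via `Discharge/Sec2Cor218iModel` (p420155) and abc-iut-w5-d051's
`Thm16Sub.thm16i_of_isKernelOfAction`, from the inputs of the [EtTh] Thm. 1.6 (i) sub-DAG — K-core EXTENSION ONLY
(G-L6d6-2, weakest form), [AbsAnab] Lem. 1.3.8 (`hΔ`), `KerToZIsCompactlyGenerated` (L02, G-L6d6-1), `GKNIsKernelOfAction D 2`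
(L04, G-w5d051-1), `GtpYNFromCusp D 2` (L05), `IsoPreservesCuspidalDecomp` (L03, [SemiAnbd] Thm. 6.5 (iii)) and a cusp of
`Y^log` in `Π^tp_Y` [cite: MochizukiEtTh2009, Thm 1.6 (i) p.24]. Proof-only: no definition, no new named fact; nothing
disputed is asserted; no side is taken on [IUTchIII] Cor. 3.12; typed ≠ discharged.
-/

noncomputable section

namespace Literature.IUT.HodgeArakelov

open Literature.AnabelianGeometry.EtaleTheta

namespace EtaleThetaDataOfSetting

variable {p : ℕ} [Fact p.Prime] {D : Literature.AnabelianGeometry.EtaleTheta.ThetaSetting p}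
  {E : D.EtaleThetaData} {l : ℕ} (C : E.DoubleUnderline l)

/-- **(H1) from the [EtTh] Thm. 1.6 (i) sub-DAG inputs** (no `Π^tp_Ÿ`-stabilisation assumed): every topological
automorphism of `Π^tp_{X̲̲}` stabilises `Π^tp_{Ÿ̲̲}`, granted a K-core extension to `Π^tp_X`, [AbsAnab] Lem. 1.3.8, and the
L02/L04/L05/L03 binders + a cusp of `Y^log`. [claim: Mochizuki2012, status: disputed] (IUTchII §1 Prop 1.4, kurims p.27) -/
theorem piYddCharacteristic_of_thm16Inputs
    (hext₀ : ∀ γ : C.Huu ≃ₜ* C.Huu, ∃ Γ : D.PiTemp ≃ₜ* D.PiTemp,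
      ∀ h : C.Huu, Γ (h : D.PiTemp) = ((γ h : C.Huu) : D.PiTemp))
    (hΔ : ∀ Γ : D.PiTemp ≃ₜ* D.PiTemp, D.DeltaTemp.map Γ.toMulEquiv.toMonoidHom = D.DeltaTemp)
    (hZ : Thm16Sub.KerToZIsCompactlyGenerated D) (hK : Thm16Sub.GKNIsKernelOfAction D 2)
    (hYN : Thm16Sub.GtpYNFromCusp D 2) (h65 : D.IsoPreservesCuspidalDecomp D.toTemperedCurve)
    (hex : ∃ Dc : Subgroup D.PiTemp, D.IsCuspidalDecompositionGroup Dc ∧ Dc ≤ D.GtpY) :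
    PiYddCharacteristic C := by
  refine piYddCharacteristic_of_prop24 C fun γ => ?_
  obtain ⟨Γ, hΓ⟩ := hext₀ γ
  exact ⟨Γ, hΓ, ThetaSetting.EtaleThetaData.DoubleUnderline.map_GtpYdd_eq_of_thm16Inputs Γ (hΔ Γ) hZ hK hYN h65 hex⟩

end EtaleThetaDataOfSetting

end Literature.IUT.HodgeArakelov

end
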